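import Mathlib
import HarnessLib
import Summits.AnomalousDissipation.AnomalousDissipation.Theses.PointSink

/-!
# Stub `stub_orient` — orienting a point-flux cone (crux `PointSink.ConeDesingularisation`, line `Sketch`)

A point-flux cone (`PointSink.PointFluxCone`) is a discretely self-similar weak Euler cone
`(λ, V, P)` on `ℝ³ ∖ {0}` whose radial energy-flux log-mean
`∫_{1<|x|<λ} (½|V|² + P)(V·x)/|x|²` is NON-ZERO. The desingularisation line needs it ORIENTED: the
log-mean must be NEGATIVE (the soliton's far field carries energy inward). If the given cone has
positive log-mean we replace `V` by `−V` and keep `λ` and `P`: measurability, the DSS laws (linear in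
`V`), the local integrability of `|V|²` (`‖−v‖ = ‖v‖`), the weak Euler identity (quadratic in `V`),
the weak divergence identity (linear in `V`, `−0 = 0`) and the integrability of the flux density are
preserved, while the flux density `(½|V|² + P)(V·x)/|x|²` is odd in `V`, so its integral flips sign.
-/

noncomputable section

-- `Summit.<Summit>.<Problem>`: single-conjunct summit, the duplicate namespace is mandated (CONVENTIONS §2).
set_option linter.dupNamespace false

namespace Summit.AnomalousDissipation.AnomalousDissipation.Theorems

open MeasureTheory Filter Topology Set
open Literature.Analysis.FunctionSpaces Literature.Analysis.FluidPDE

/-- Points / velocity values of `ℝ³`. -/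
local notation "E³" => EuclideanSpace ℝ (Fin 3)

/-- The radial energy-flux density is odd in the velocity: replacing `V` by `−V` negates
`(½|V|² + P)(V·x)/|x|²` pointwise. -/
private theorem coneOrient_fluxDensity_neg (V : E³ → E³) (P : E³ → ℝ) :
    (fun x : E³ => (‖-V x‖ ^ 2 / 2 + P x) * (inner ℝ (-V x) x / ‖x‖ ^ 2)) =
      fun x => -((‖V x‖ ^ 2 / 2 + P x) * (inner ℝ (V x) x / ‖x‖ ^ 2)) := by
  funext x
  rw [norm_neg, inner_neg_left, neg_div, mul_neg]

/-- **`stub_orient`.** A point-flux cone may be taken with NEGATIVE (inward) radial energy-flux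
log-mean: if the given cone `(λ, V, P)` has positive log-mean, the cone `(λ, −V, P)` satisfies every
clause of `PointFluxCone` (measurability, the DSS laws, local integrability off the origin, the weak
Euler identity — quadratic in `V` —, the weak divergence identity — linear in `V` — and the
integrability of the flux density on the fundamental shell), and its flux log-mean is the negative
of the old one. -/
theorem stub_orient :
    Summit.AnomalousDissipation.AnomalousDissipation.Theses.PointSink.PointFluxCone →
    ∃ (lam : ℝ) (V : E³ → E³) (P : E³ → ℝ), 1 < lam ∧ AEStronglyMeasurable V volume ∧
      (∀ x : E³, x ≠ 0 → V (lam • x) = lam ^ (-(2 / 3 : ℝ)) • V x) ∧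
      (∀ x : E³, x ≠ 0 → P (lam • x) = lam ^ (-(4 / 3 : ℝ)) * P x) ∧
      LocallyIntegrableOn (fun x => ‖V x‖ ^ 2) {x : E³ | x ≠ 0} volume ∧
      LocallyIntegrableOn P {x : E³ | x ≠ 0} volume ∧
      (∀ φ : E³ → E³, IsTestFunctionOn ⟨{x : E³ | x ≠ 0}, isOpen_ne⟩ φ →
        ∫ x, (inner ℝ (V x) (fderiv ℝ φ x (V x)) + P x * VectorCalculus.divergence φ x) = 0) ∧
      (∀ θ : E³ → ℝ, IsTestFunctionOn ⟨{x : E³ | x ≠ 0}, isOpen_ne⟩ θ →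
        ∫ x, inner ℝ (V x) (gradient θ x) = 0) ∧
      IntegrableOn (fun x => (‖V x‖ ^ 2 / 2 + P x) * (inner ℝ (V x) x / ‖x‖ ^ 2))
        {x : E³ | 1 < ‖x‖ ∧ ‖x‖ < lam} volume ∧
      (∫ x in {x : E³ | 1 < ‖x‖ ∧ ‖x‖ < lam}, (‖V x‖ ^ 2 / 2 + P x) * (inner ℝ (V x) x / ‖x‖ ^ 2)) < 0 := by
  rintro ⟨lam, V, P, hlam, hV, hVdss, hPdss, hVloc, hPloc, hEuler, hdiv, hint, hne⟩
  rcases lt_or_gt_of_ne hne with hlt | hgt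
  · -- Already inward: keep the witnesses.
    exact ⟨lam, V, P, hlam, hV, hVdss, hPdss, hVloc, hPloc, hEuler, hdiv, hint, hlt⟩
  · -- Outward: flip the velocity.
    refine ⟨lam, fun x => -V x, P, hlam, hV.neg, ?_, hPdss, ?_, hPloc, ?_, ?_, ?_, ?_⟩
    · -- DSS law, linear in `V`.
      intro x hx
      beta_reduce
      rw [hVdss x hx, smul_neg]
    · -- `‖−V x‖² = ‖V x‖²`.
      simpa only [norm_neg] using hVloc
    · -- Weak Euler identity, quadratic in `V`.
      intro φ hφ
      simpa only [map_neg, inner_neg_neg] using hEuler φ hφ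
    · -- Weak divergence identity, linear in `V`.
      intro θ hθ
      have h0 := hdiv θ hθ
      simp only [inner_neg_left, integral_neg, h0, neg_zero]
    · -- Integrability of the (negated) flux density.
      rw [coneOrient_fluxDensity_neg V P]
      exact hint.neg
    · -- The flux log-mean flips sign.
      rw [coneOrient_fluxDensity_neg V P, integral_neg]
      exact neg_neg_of_pos hgt

end Summit.AnomalousDissipation.AnomalousDissipation.Theorems

end
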